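import Literature.AnabelianGeometry.EtaleTheta.Discharge.Sec5Thm57LevelOne
import Literature.AnabelianGeometry.EtaleTheta.Discharge.Sec5ModelCase

/-!
# [EtTh] §5, Theorem 5.7 at ALL levels from ONE compatible family of identifications (pp. 318–319, 329–331 / PDF pp. 92–93, 103–105)

Mochizuki, *The étale theta function …*, Publ. RIMS **45** (2009)
[cite: MochizukiEtTh2009, Thm 5.7 p.330 (PDF p.104); Rmk 4.3.2 p.318–319 (PDF pp.92–93); Prop 4.2 (iv) p.315 (PDF p.89)].
Seat abc-iut-L2-d4 (gen 4; node `EtTh:Thm5.7`); PROOF-ONLY, over abc-iut-L2-t4's `ThetaFrobenioidTower` /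
`RootTransport` vocabulary (`FrobenioidThetaTower.lean`, `FrobenioidRootTransport.lean`) and this seat's
`Discharge/Sec5Thm57Descent.lean` (`hζ_of_descent`), `…LevelOne.lean` (`hζ₁_of_constTorsion`), `…ModelCase.lean`
(`rootTransportWith_of_rootOfUnity`).

THE POINT.  abc-iut-L2-t4's `ThetaRootPreserved Ψ` quantifies over ALL identifications `α : Ψ(A_N) ⥲ A_N`,
`β : Ψ(B_N) ⥲ B_N`; print (Thm. 5.7, p.330; Prop. 5.1 / Thm. 4.4 (i)) works with ONE chosen isomorphism.  The two are
EQUIVALENT: changing `α` by an automorphism of `A_N` is absorbed into the witness `e` (abc-iut-L2-t4's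
`rootTransport_of_comp_left`, the `ζ_A`-freedom of Prop. 4.2 (iv)), and changing `β` by an automorphism `b` of `B_N`
multiplies BOTH `D_c` and `D_p` by `b` on the same side, leaving the discrepancy `u = D_c⁻¹·D_p` — hence the whole
rigidity clause — UNCHANGED (`rootTransport_of_comp_right`, this file).  Consequently
(`thetaRootPreserved_of_rootTransport`, `thetaRootPreservedAll_of_rootTransport_family`) Theorem 5.7 for all choices
follows from a root transport for ONE pair `(α₀, β₀)` per level, and the capstone can take its `Ψ`-side inputs in the
∃-form in which the cell's producers deliver them (abc-iut-w5-d245's `exists_unit_transports_ofBiKummerData`: ONE unit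
`e`, `D_c = 1`, a unit `D_p`, and `StrvTransport` for that `e`):
`ThetaFrobenioidTower.thetaRootPreservedAll_of_chosenFamily` — **[EtTh] Thm. 5.7 (root level) at ALL levels from ONE
family of transport data `(α_N, β_N, e_N, D_c^N, D_p^N)_N` COMPATIBLE with the transitions `α_{1,N}, β_{1,N}` down to
the first root** ("by allowing `N` to vary, we obtain a compatible system", Rmk. 4.3.2 p.319; "`Ψ` maps the transition
diagrams to transition diagrams", Cor. 5.12 setting p.339), the unit law along `β_{1,N}` (`hconst`, PROVED for the
assembled towers modulo the naturality of the constants: `hconst_ofBiKummerFamily'`), the LEVEL-1 §5 facts, the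
Thm. 4.4 (iv)/Prop. 2.4 transport `θ₁` of `s^trv_1` for THE chosen level-1 datum (`hstrv₁`, `hYdd₁`), and the ONE
anabelian residual `hc` (the level-1 discrepancy constant is a `2l`-th root of unity) — with NO divisor-matching
hypothesis `∀ α β ∃ e` (`hdiv`), NO universally quantified descent (`hdesc`) and NO `∀`-form `hθ₁`, and none of the
[FrdI] inputs (`hiso`, `hiiid`, `hpre`, `hbe`) that served only to manufacture transports for arbitrary `(α, β)`.
HONEST FRAMING: kernel-checked implications between typed statements about the §5 data under named hypotheses;
nothing of [EtTh] is asserted unconditionally; typed ≠ discharged; no side taken on anything downstream. -/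

namespace Literature.AnabelianGeometry.EtaleTheta

open CategoryTheory
open Literature.AlgebraicGeometry.Frobenioids

universe w v v' u u'

namespace ThetaFrobenioid

variable {C : Type u} [Category.{v} C] {D : Type u'} [Category.{v'} D] (𝔉 : ThetaFrobenioid.{w} C D)

/-- **Changing `β` by an automorphism of `B_N` does not affect the root transport**: `D_c`, `D_p` are both
multiplied by `b`, so the discrepancy `D_c⁻¹·D_p` and its rigidity clause are unchanged (Thm. 5.7 is a statement about
the PAIR `(s^⊓_N, s^⊔_N)`, p.330 (PDF p.104)).  Companion of abc-iut-L2-t4's `rootTransport_of_comp_left`.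
[cite: MochizukiEtTh2009, Thm 5.7 p.329–330 (PDF pp.103–104)] -/
theorem rootTransport_of_comp_right {Ψ : C ≌ C} {α : Ψ.functor.obj 𝔉.AN ≅ 𝔉.AN} {β : Ψ.functor.obj 𝔉.BN ≅ 𝔉.BN}
    (h : 𝔉.RootTransport Ψ α β) (b : Aut 𝔉.BN) : 𝔉.RootTransport Ψ α (β ≪≫ b) := by
  obtain ⟨e, Dc, Dp, h1, h2, δ₂, hδ₂, δ₃, hδ₃, heq⟩ := h
  refine ⟨e, b * Dc, b * Dp, ?_, ?_, δ₂, hδ₂, δ₃, hδ₃, ?_⟩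
  · have h1' := h1 =≫ b.hom
    simp only [Category.assoc] at h1'
    rw [Iso.trans_hom, h1', Aut.Aut_mul_def, Iso.trans_hom]
  · have h2' := h2 =≫ b.hom
    simp only [Category.assoc] at h2'
    rw [Iso.trans_hom, h2', Aut.Aut_mul_def, Iso.trans_hom]
  · rw [mul_inv_rev, mul_assoc, inv_mul_cancel_left]
    exact heq

/-- **Theorem 5.7 for ALL identifications from ONE**: a root transport for a single pair `(α₀, β₀)` gives
`ThetaRootPreserved Ψ` (any other pair differs by automorphisms of `A_N`, `B_N`, absorbed by
`rootTransport_of_comp_left` / `rootTransport_of_comp_right`).  [cite: MochizukiEtTh2009, Thm 5.7 p.329–330 (PDF pp.103–104); Prop 4.2 (iv) p.315 (PDF p.89)] -/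
theorem thetaRootPreserved_of_rootTransport {Ψ : C ≌ C} {α₀ : Ψ.functor.obj 𝔉.AN ≅ 𝔉.AN}
    {β₀ : Ψ.functor.obj 𝔉.BN ≅ 𝔉.BN} (h : 𝔉.RootTransport Ψ α₀ β₀) : 𝔉.ThetaRootPreserved Ψ := by
  intro α β
  have h' := 𝔉.rootTransport_of_comp_left (𝔉.rootTransport_of_comp_right h (β₀.symm ≪≫ β)) (α₀.symm ≪≫ α)
  rwa [Iso.self_symm_id_assoc, Iso.self_symm_id_assoc] at h'

end ThetaFrobenioid

namespace ThetaFrobenioidTower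

variable {C : Type u} [Category.{v} C] {D : Type u'} [Category.{v'} D] (𝔗 : ThetaFrobenioidTower.{w} C D)
  (Ψ : C ≌ C)

/-- **Theorem 5.7 at ALL levels for ALL identifications from ONE root transport per level.**
[cite: MochizukiEtTh2009, Thm 5.7 p.329–330 (PDF pp.103–104)] -/
theorem thetaRootPreservedAll_of_rootTransport_family
    (h : ∀ N : ℕ+, ∃ (α : Ψ.functor.obj (𝔗.AN N) ≅ 𝔗.AN N) (β : Ψ.functor.obj (𝔗.BN N) ≅ 𝔗.BN N),
      (𝔗.atLevel N).RootTransport Ψ α β) :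
    𝔗.ThetaRootPreservedAll Ψ := by
  intro N
  obtain ⟨α, β, hαβ⟩ := h N
  exact (𝔗.atLevel N).thetaRootPreserved_of_rootTransport hαβ

/-- **`RootTransportWith` at level `N` for a CHOSEN transport datum compatible with a CHOSEN level-1 datum.**  Given
the level-`N` datum `(α, β, e, D_c, D_p)` (transport equations `hT`, `hT'`, unit discrepancy `hu`) and a level-`1` datum
`(α₁, β₁, e₁, D_c¹, D_p¹)` compatible with the transitions `α_{1,N}, β_{1,N}` (`hΨα`, `hΨβ`, `he`), the unit law along
`β_{1,N}` (`hconst`), the level-1 §5 facts, `Ψ^Aut(O^×(B_1)) = O^×(B_1)` for `β₁`, the Thm. 4.4 (iv)/Prop. 2.4 transport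
`θ₁` for THIS level-1 datum and the torsion `hc` of its discrepancy constant: Theorem 5.7 at the `N`-th root with
witnesses `(e, D_c, D_p)` — `hζ₁_of_constTorsion` + `hζ_of_descent` + `rootTransportWith_of_rootOfUnity`.
[cite: MochizukiEtTh2009, Thm 5.7 p.329–330 (PDF pp.103–104); Rmk 4.3.2 p.318–319 (PDF pp.92–93); Lem 5.8 p.331 (PDF p.105)] -/
theorem rootTransportWith_of_chosen (hepi : ∀ ⦃X Y : C⦄ (f : X ⟶ Y), Epi f) {N : ℕ+}
    (hconst : ∀ (u : Aut (𝔗.BN N)) (hu : u ∈ (𝔗.atLevel N).units (𝔗.BN N)) (u₁ : Aut (𝔗.BN 1))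
      (hu₁ : u₁ ∈ (𝔗.atLevel 1).units (𝔗.BN 1)) (c : 𝔗.Kˣ),
      u.hom ≫ 𝔗.β (one_dvd_level N) = 𝔗.β (one_dvd_level N) ≫ u₁.hom →
      (𝔗.atLevel 1).unitsToBirat (𝔗.BN 1) ⟨u₁, hu₁⟩ = 𝔗.constEmb 1 c →
        (𝔗.atLevel N).unitsToBirat (𝔗.BN N) ⟨u, hu⟩ ^ (N : ℕ) = 𝔗.constEmb N c)
    (hcap₁ : (𝔗.atLevel 1).SgpCapSpec) (hcup₁ : (𝔗.atLevel 1).SgpCupSpec)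
    (hdiff₁ : (𝔗.atLevel 1).BiKummerDifferenceMem) (h58₁ : (𝔗.atLevel 1).ConstantsActByCyclotome)
    (hfac₁ : ∀ y ∈ (𝔗.atLevel 1).imPiY, ∃ h ∈ (𝔗.atLevel 1).HB, ∀ u ∈ (𝔗.atLevel 1).units (𝔗.BN 1),
      𝔗.sgpCap 1 y * u * (𝔗.sgpCap 1 y)⁻¹ = 𝔗.sgpCap 1 h * u * (𝔗.sgpCap 1 h)⁻¹)
    {α : Ψ.functor.obj (𝔗.AN N) ≅ 𝔗.AN N} {β : Ψ.functor.obj (𝔗.BN N) ≅ 𝔗.BN N} {e : 𝔗.AN N ≅ 𝔗.AN N}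
    {Dc Dp : Aut (𝔗.BN N)}
    (hT : α.inv ≫ Ψ.functor.map (𝔗.sCap N) ≫ β.hom = e.hom ≫ 𝔗.sCap N ≫ Dc.hom)
    (hT' : α.inv ≫ Ψ.functor.map (𝔗.sCup N) ≫ β.hom = e.hom ≫ 𝔗.sCup N ≫ Dp.hom)
    (hu : Dc⁻¹ * Dp ∈ (𝔗.atLevel N).units (𝔗.BN N))
    {α₁ : Ψ.functor.obj (𝔗.AN 1) ≅ 𝔗.AN 1} {β₁ : Ψ.functor.obj (𝔗.BN 1) ≅ 𝔗.BN 1} {e₁ : 𝔗.AN 1 ≅ 𝔗.AN 1}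
    {Dc₁ Dp₁ : Aut (𝔗.BN 1)}
    (hΨα : α.inv ≫ Ψ.functor.map (𝔗.α (one_dvd_level N)) ≫ α₁.hom = 𝔗.α (one_dvd_level N))
    (hΨβ : β.inv ≫ Ψ.functor.map (𝔗.β (one_dvd_level N)) ≫ β₁.hom = 𝔗.β (one_dvd_level N))
    (he : 𝔗.α (one_dvd_level N) ≫ e₁.hom = e.hom ≫ 𝔗.α (one_dvd_level N))
    (hT₁ : α₁.inv ≫ Ψ.functor.map (𝔗.sCap 1) ≫ β₁.hom = e₁.hom ≫ 𝔗.sCap 1 ≫ Dc₁.hom)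
    (hT₁' : α₁.inv ≫ Ψ.functor.map (𝔗.sCup 1) ≫ β₁.hom = e₁.hom ≫ 𝔗.sCup 1 ≫ Dp₁.hom)
    (hu₁ : Dc₁⁻¹ * Dp₁ ∈ (𝔗.atLevel 1).units (𝔗.BN 1))
    (hU₁ : ((𝔗.atLevel 1).units (𝔗.BN 1)).map ((𝔗.atLevel 1).psiAut Ψ β₁) = (𝔗.atLevel 1).units (𝔗.BN 1))
    (θ₁ : Aut (𝔗.pre.base.obj (𝔗.BN 1)) ≃* Aut (𝔗.pre.base.obj (𝔗.BN 1)))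
    (hstrv₁ : (𝔗.atLevel 1).StrvTransport Ψ α₁ e₁ θ₁)
    (hYdd₁ : (𝔗.atLevel 1).HB.map θ₁.toMonoidHom = (𝔗.atLevel 1).HB)
    (hc : ∀ c : 𝔗.Kˣ, (𝔗.atLevel 1).unitsToBirat (𝔗.BN 1) ⟨Dc₁⁻¹ * Dp₁, hu₁⟩ = 𝔗.constEmb 1 c →
      c ^ (2 * 𝔗.l) = 1) :
    (𝔗.atLevel N).RootTransportWith Ψ α β e Dc Dp := by
  have hζ₁ := 𝔗.hζ₁_of_constTorsion Ψ hepi hcap₁ hcup₁ hdiff₁ h58₁ hfac₁ θ₁ hU₁ hT₁ hT₁' hstrv₁ hYdd₁ hu₁ hc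
  obtain ⟨ζ, hζ, hpow⟩ := 𝔗.hζ_of_descent Ψ hepi hconst hT hT' hu hΨα hΨβ he hT₁ hT₁' hu₁ hζ₁
  exact ThetaFrobenioid.rootTransportWith_of_rootOfUnity (𝔉 := 𝔗.atLevel N) Ψ α β hT hT' hu ζ hζ hpow

/-- **[EtTh] Theorem 5.7 (root level) at ALL levels from ONE compatible family of transport data.**  Inputs: the
family `(α_N, β_N, e_N, D_c^N, D_p^N)_N` with its transport equations and unit discrepancies (`hT`, `hT'`, `hu`); its
compatibility with the transitions to the first root (`hΨα`, `hΨβ`, `he` — Rmk. 4.3.2 / Cor. 5.12 setting); the unit law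
along `β_{1,N}` (`hconst`); `C` totally epimorphic (`hepi`); AT LEVEL 1 ONLY: the §5 facts `SgpCapSpec`, `SgpCupSpec`,
Prop. 4.3 (iii), Lemma 5.8 (by name), the factorisation `hfac₁` (GAP G-L2d4-1), `Ψ^Aut(O^×(B_1)) = O^×(B_1)` for `β_1`,
the Thm. 4.4 (iv)/Prop. 2.4 transport `θ₁` of `s^trv_1` for the chosen level-1 datum (`hstrv₁`, `hYdd₁`); and the ONE
anabelian residual `hc`.  Output: `ThetaRootPreservedAll Ψ` (all levels, ALL identifications).
[cite: MochizukiEtTh2009, Thm 5.7 p.329–330 (PDF pp.103–104); Rmk 4.3.2 p.318–319 (PDF pp.92–93); Rmk 5.7.1 p.330 (PDF p.104)] -/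
theorem thetaRootPreservedAll_of_chosenFamily (hepi : ∀ ⦃X Y : C⦄ (f : X ⟶ Y), Epi f)
    (hconst : ∀ (N : ℕ+) (u : Aut (𝔗.BN N)) (hu : u ∈ (𝔗.atLevel N).units (𝔗.BN N)) (u₁ : Aut (𝔗.BN 1))
      (hu₁ : u₁ ∈ (𝔗.atLevel 1).units (𝔗.BN 1)) (c : 𝔗.Kˣ),
      u.hom ≫ 𝔗.β (one_dvd_level N) = 𝔗.β (one_dvd_level N) ≫ u₁.hom →
      (𝔗.atLevel 1).unitsToBirat (𝔗.BN 1) ⟨u₁, hu₁⟩ = 𝔗.constEmb 1 c →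
        (𝔗.atLevel N).unitsToBirat (𝔗.BN N) ⟨u, hu⟩ ^ (N : ℕ) = 𝔗.constEmb N c)
    (hcap₁ : (𝔗.atLevel 1).SgpCapSpec) (hcup₁ : (𝔗.atLevel 1).SgpCupSpec)
    (hdiff₁ : (𝔗.atLevel 1).BiKummerDifferenceMem) (h58₁ : (𝔗.atLevel 1).ConstantsActByCyclotome)
    (hfac₁ : ∀ y ∈ (𝔗.atLevel 1).imPiY, ∃ h ∈ (𝔗.atLevel 1).HB, ∀ u ∈ (𝔗.atLevel 1).units (𝔗.BN 1),
      𝔗.sgpCap 1 y * u * (𝔗.sgpCap 1 y)⁻¹ = 𝔗.sgpCap 1 h * u * (𝔗.sgpCap 1 h)⁻¹)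
    (αf : ∀ N : ℕ+, Ψ.functor.obj (𝔗.AN N) ≅ 𝔗.AN N) (βf : ∀ N : ℕ+, Ψ.functor.obj (𝔗.BN N) ≅ 𝔗.BN N)
    (ef : ∀ N : ℕ+, 𝔗.AN N ≅ 𝔗.AN N) (Dcf Dpf : ∀ N : ℕ+, Aut (𝔗.BN N))
    (hT : ∀ N : ℕ+, (αf N).inv ≫ Ψ.functor.map (𝔗.sCap N) ≫ (βf N).hom = (ef N).hom ≫ 𝔗.sCap N ≫ (Dcf N).hom)
    (hT' : ∀ N : ℕ+, (αf N).inv ≫ Ψ.functor.map (𝔗.sCup N) ≫ (βf N).hom = (ef N).hom ≫ 𝔗.sCup N ≫ (Dpf N).hom)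
    (hu : ∀ N : ℕ+, (Dcf N)⁻¹ * Dpf N ∈ (𝔗.atLevel N).units (𝔗.BN N))
    (hΨα : ∀ N : ℕ+,
      (αf N).inv ≫ Ψ.functor.map (𝔗.α (one_dvd_level N)) ≫ (αf 1).hom = 𝔗.α (one_dvd_level N))
    (hΨβ : ∀ N : ℕ+,
      (βf N).inv ≫ Ψ.functor.map (𝔗.β (one_dvd_level N)) ≫ (βf 1).hom = 𝔗.β (one_dvd_level N))
    (he : ∀ N : ℕ+, 𝔗.α (one_dvd_level N) ≫ (ef 1).hom = (ef N).hom ≫ 𝔗.α (one_dvd_level N))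
    (hU₁ : ((𝔗.atLevel 1).units (𝔗.BN 1)).map ((𝔗.atLevel 1).psiAut Ψ (βf 1)) = (𝔗.atLevel 1).units (𝔗.BN 1))
    (θ₁ : Aut (𝔗.pre.base.obj (𝔗.BN 1)) ≃* Aut (𝔗.pre.base.obj (𝔗.BN 1)))
    (hstrv₁ : (𝔗.atLevel 1).StrvTransport Ψ (αf 1) (ef 1) θ₁)
    (hYdd₁ : (𝔗.atLevel 1).HB.map θ₁.toMonoidHom = (𝔗.atLevel 1).HB)
    (hc : ∀ c : 𝔗.Kˣ, (𝔗.atLevel 1).unitsToBirat (𝔗.BN 1) ⟨(Dcf 1)⁻¹ * Dpf 1, hu 1⟩ = 𝔗.constEmb 1 c →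
      c ^ (2 * 𝔗.l) = 1) :
    𝔗.ThetaRootPreservedAll Ψ :=
  𝔗.thetaRootPreservedAll_of_rootTransport_family Ψ fun N =>
    ⟨αf N, βf N, ThetaFrobenioid.RootTransportWith.rootTransport (𝔗.atLevel N)
      (𝔗.rootTransportWith_of_chosen Ψ hepi (hconst N) hcap₁ hcup₁ hdiff₁ h58₁ hfac₁ (hT N) (hT' N) (hu N)
        (hΨα N) (hΨβ N) (he N) (hT 1) (hT' 1) (hu 1) hU₁ θ₁ hstrv₁ hYdd₁ hc)⟩

end ThetaFrobenioidTower

end Literature.AnabelianGeometry.EtaleTheta
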